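import Mathlib
import Summits.Schanuel.Schanuel.Theses.GaussianStokesSector

/-!
# Line `schanuel-split` for crux `MixedTripleIndependent` (stmt-Schanuel-13740)

BC2-redirect decomposition of the 3-number crux
`MixedTripleIndependent : AlgebraicIndependent ℚ ![e, I, J]`,
`I = ∫₀¹ e^{-x²} dx`, `J = ∫₀^∞ e^{-x}/√(1+x) dx`, into

* `stub_ePiAlgIndependent` — `e` and `π` are algebraically independent over `ℚ`
  (the SCHANUEL INSTANCE inside the crux: Schanuel at `(1, πi)`);
* `stub_gaussValueRelTranscendental` — for every real algebraic `a > 0` the Gaussian E-value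
  `F(a) = ∫₀¹ e^{-a x²} dx` is transcendental over the field `ℚ(e^a, π)` (the SCHANUEL-FREE half of
  the route's rank-2 crux `PiFreeOverGaussianEValues` at `d = 1`: by the tower law
  `trdeg ℚ(π, e^a, F(a)) = 3 ⟺ (π ⊥ e^a) ∧ (F(a) ∉ ℚ(π, e^a)^alg)`; uniform in the algebraic point
  like every Siegel–Shidlovskii statement; at `a = 1` and GIVEN `e ⊥ π` it is the crux, while if
  `e, π` were dependent its `a = 1` case would be Shidlovskii's theorem `trdeg ℚ(e, F(1)) = 2`).

The assembly `mixedTripleIndependent_of_pieces : X₁ → X₂ → ⟨crux statement⟩` is PROVED below (no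
sorry, standard axioms) and `MixedTripleIndependent_of : MixedTripleIndependent` applies it to the two
stubs (the only sorries of the file):
tower law (`AlgebraicIndependent.option_iff_transcendental`) + the STOKES IDENTITY
`√π = 2 I + J / e` (Gaussian integral on `(0, ∞)` split at `1`, substitution `u = x² − 1` on
`(1, ∞)`), which puts `√π`, hence `π`, in the relative algebraic closure of `ℚ(e, I, J)`.
-/

namespace Summit.Schanuel.Schanuel.Cruxes.MixedTripleIndependent.SchanuelSplit

open Summit.Schanuel.Schanuel.Theses.GaussianStokesSector
open Real MeasureTheory Set Filter

/-- STUB 1 (piece X₁, the Schanuel instance): `e` and `π` are algebraically independent. -/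
theorem stub_ePiAlgIndependent : AlgebraicIndependent ℚ ![Real.exp 1, Real.pi] := by
  sorry

/-- STUB 2 (piece X₂, the Schanuel-free remainder, uniform in the algebraic point): for every real
algebraic `a > 0`, `∫₀¹ e^{-a x²} dx` is transcendental over the field `ℚ(e^a, π)`. -/
theorem stub_gaussValueRelTranscendental :
    ∀ a : ℝ, IsAlgebraic ℚ a → 0 < a →
      Transcendental ↥(IntermediateField.adjoin ℚ ({Real.exp a, Real.pi} : Set ℝ))
        (∫ x in (0:ℝ)..1, Real.exp (-(a * x ^ 2))) := by
  sorry

/-! ## The Stokes identity `√π = 2∫₀¹e^{-x²} + e⁻¹ ∫₀^∞ e^{-x}/√(1+x)` -/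

/-- The Gaussian integrand `e^{-x²}` is integrable on `ℝ`. -/
theorem integrable_exp_neg_sq : Integrable (fun x : ℝ => Real.exp (-x ^ 2)) := by
  simpa [neg_mul, one_mul] using integrable_exp_neg_mul_sq (zero_lt_one)

/-- `∫_{(0,∞)} e^{-x²} dx = √π / 2`. -/
theorem integral_exp_neg_sq_Ioi : ∫ x in Ioi (0:ℝ), Real.exp (-x ^ 2) = √π / 2 := by
  simpa [neg_mul, one_mul] using integral_gaussian_Ioi 1

/-- Pointwise form of the substitution `u = x² − 1` in `∫₀^∞ e^{-u}/√(1+u) du`. -/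
theorem subst_integrand_eq {x : ℝ} (hx : 0 < x) :
    Real.exp (-(x ^ 2 - 1)) / Real.sqrt (1 + (x ^ 2 - 1)) * (2 * x)
      = 2 * Real.exp 1 * Real.exp (-x ^ 2) := by
  have h1 : (1 : ℝ) + (x ^ 2 - 1) = x ^ 2 := by ring
  rw [h1, Real.sqrt_sq hx.le]
  have h2 : -(x ^ 2 - 1) = 1 + -x ^ 2 := by ring
  rw [h2, Real.exp_add]
  have hx' : x ≠ 0 := hx.ne'
  field_simp

/-- `∫₀^∞ e^{-u}/√(1+u) du = 2e · ∫₁^∞ e^{-x²} dx` (substitution `u = x² − 1`). -/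
theorem integral_J_eq :
    ∫ u in Ioi (0:ℝ), Real.exp (-u) / Real.sqrt (1 + u)
      = 2 * Real.exp 1 * ∫ x in Ioi (1:ℝ), Real.exp (-x ^ 2) := by
  set g : ℝ → ℝ := fun u => Real.exp (-u) / Real.sqrt (1 + u) with hg
  set f : ℝ → ℝ := fun x => x ^ 2 - 1 with hf
  set f' : ℝ → ℝ := fun x => 2 * x with hf'
  have hfc : ContinuousOn f (Ici 1) := by
    rw [hf]; fun_prop
  have hft : Tendsto f atTop atTop := by
    rw [hf]
    have h := tendsto_atTop_add_const_right atTop (-1 : ℝ) (tendsto_pow_atTop two_ne_zero)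
    simpa [sub_eq_add_neg] using h
  have hff' : ∀ x ∈ Ioi (1:ℝ), HasDerivWithinAt f (f' x) (Ioi x) x := by
    intro x _
    have h : HasDerivAt f (f' x) x := by
      rw [hf, hf']
      simpa using ((hasDerivAt_pow 2 x).sub_const (1:ℝ))
    exact h.hasDerivWithinAt
  have himIci : f '' Ici 1 ⊆ Ici 0 := by
    rintro u ⟨x, hx, rfl⟩
    simp only [mem_Ici, hf] at hx ⊢
    nlinarith
  have himIoi : f '' Ioi 1 ⊆ Ioi 0 := by
    rintro u ⟨x, hx, rfl⟩
    simp only [mem_Ioi, hf] at hx ⊢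
    nlinarith
  have hgc : ContinuousOn g (Ici 0) := by
    rw [hg]
    apply ContinuousOn.div
    · fun_prop
    · fun_prop
    · intro u hu
      simp only [mem_Ici] at hu
      exact (Real.sqrt_pos.mpr (by linarith)).ne'
  have hgi : IntegrableOn g (Ici 0) := by
    rw [integrableOn_Ici_iff_integrableOn_Ioi]
    have hexp : IntegrableOn (fun u : ℝ => Real.exp (-u)) (Ioi 0) := integrableOn_exp_neg_Ioi 0
    refine hexp.mono' ?_ ?_
    · exact (hgc.mono Ioi_subset_Ici_self).aestronglyMeasurable measurableSet_Ioi
    · filter_upwards [ae_restrict_mem measurableSet_Ioi] with u hu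
      simp only [mem_Ioi] at hu
      rw [hg]
      simp only
      rw [Real.norm_eq_abs, abs_of_nonneg (div_nonneg (Real.exp_pos _).le (Real.sqrt_nonneg _))]
      apply div_le_self (Real.exp_pos _).le
      have h1 : Real.sqrt 1 ≤ Real.sqrt (1 + u) := Real.sqrt_le_sqrt (by linarith)
      rwa [Real.sqrt_one] at h1
  have key : ∀ x ∈ Ici (1:ℝ), (g ∘ f) x * f' x = 2 * Real.exp 1 * Real.exp (-x ^ 2) := by
    intro x hx
    simp only [mem_Ici] at hx
    simp only [Function.comp_apply, hg, hf, hf']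
    exact subst_integrand_eq (by linarith)
  have hg2 : IntegrableOn (fun x => (g ∘ f) x * f' x) (Ici 1) := by
    have h2 : IntegrableOn (fun x : ℝ => 2 * Real.exp 1 * Real.exp (-x ^ 2)) (Ici 1) :=
      (integrable_exp_neg_sq.const_mul _).integrableOn
    exact h2.congr_fun (fun x hx => (key x hx).symm) measurableSet_Ici
  have hcv := integral_comp_mul_deriv_Ioi hfc hft hff' (hgc.mono (himIoi.trans Ioi_subset_Ici_self))
    (hgi.mono_set himIci) hg2
  have hf1 : f 1 = 0 := by simp [hf]
  rw [hf1] at hcv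
  rw [← hcv]
  have : ∫ x in Ioi (1:ℝ), (g ∘ f) x * f' x = ∫ x in Ioi (1:ℝ), 2 * Real.exp 1 * Real.exp (-x ^ 2) :=
    setIntegral_congr_fun measurableSet_Ioi (fun x hx => key x (show (1:ℝ) ≤ x from le_of_lt hx))
  rw [this, MeasureTheory.integral_const_mul]

/-- **Stokes identity** at `z = 1` (route support item `StokesIdentity`, stmt-Schanuel-13744):
`√π = 2 ∫₀¹ e^{-x²} dx + e⁻¹ ∫₀^∞ e^{-x}/√(1+x) dx`. -/
theorem stokesIdentity : StokesIdentity := by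
  unfold StokesIdentity
  have hsplit := intervalIntegral.integral_interval_add_Ioi (a := (0:ℝ)) (b := 1)
    (f := fun x : ℝ => Real.exp (-x ^ 2)) (μ := volume)
    integrable_exp_neg_sq.integrableOn integrable_exp_neg_sq.integrableOn
  rw [integral_exp_neg_sq_Ioi] at hsplit
  have hJ := integral_J_eq
  have he : Real.exp 1 ≠ 0 := (Real.exp_pos 1).ne'
  have hT : ∫ x in Ioi (1:ℝ), Real.exp (-x ^ 2)
      = (Real.exp 1)⁻¹ * (∫ u in Ioi (0:ℝ), Real.exp (-u) / Real.sqrt (1 + u)) / 2 := by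
    rw [hJ]; field_simp
  rw [hT] at hsplit
  linarith

/-! ## The algebra: tower law over `ℚ(e, I)` -/

/-- Reindexing helper: values of `![a, b]`. -/
theorem range_vec2 (a b : ℝ) : Set.range ![a, b] = {a, b} := by
  ext x
  simp only [Set.mem_range, Set.mem_insert_iff, Set.mem_singleton_iff]
  constructor
  · rintro ⟨i, rfl⟩
    fin_cases i <;> simp
  · rintro (rfl | rfl)
    · exact ⟨0, by simp⟩
    · exact ⟨1, by simp⟩

/-- **The composition at the instance** (PROVED): `e ⊥ π` and the transcendence of
`I = ∫₀¹e^{-x²}` over `ℚ(e, π)` give the crux's statement (stated UNFOLDED here so that the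
skeleton theorem `MixedTripleIndependent_of` below is the only theorem concluding the crux by name).  Tower law twice and the Stokes
identity: from the two hypotheses `(e, π, I)` is algebraically independent, so `π` is transcendental
over `K = ℚ(e, I)`; if `J` were algebraic over `K` then so would be `√π = 2I + J/e` and `π = (√π)²`
(the relative algebraic closure of `K` in `ℝ` is a field) — contradiction; hence `J` is
transcendental over `K` and `(e, I, J)` is algebraically independent. -/
theorem mixedTripleIndependent_of_instance
    (h1 : AlgebraicIndependent ℚ ![Real.exp 1, Real.pi])
    (h2 : Transcendental ↥(IntermediateField.adjoin ℚ ({Real.exp 1, Real.pi} : Set ℝ))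
      (∫ x in (0:ℝ)..1, Real.exp (-x ^ 2))) :
    AlgebraicIndependent ℚ ![Real.exp 1, ∫ x in (0:ℝ)..1, Real.exp (-x ^ 2),
      ∫ x in Set.Ioi (0:ℝ), Real.exp (-x) / Real.sqrt (1 + x)] := by
  -- notation
  set e : ℝ := Real.exp 1 with he
  set I : ℝ := ∫ x in (0:ℝ)..1, Real.exp (-x ^ 2) with hI
  set J : ℝ := ∫ x in Set.Ioi (0:ℝ), Real.exp (-x) / Real.sqrt (1 + x) with hJ
  -- Step 1: `(e, π)` independent and `I` transcendental over `ℚ[e, π]` ⇒ Option-indexed triple.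
  have h2' : Transcendental (Algebra.adjoin ℚ (Set.range ![e, Real.pi])) I := by
    rw [range_vec2]
    exact IntermediateField.transcendental_adjoin_iff.mp h2
  have h3 : AlgebraicIndependent ℚ (fun o : Option (Fin 2) => o.elim I ![e, Real.pi]) :=
    (h1.option_iff_transcendental I).mpr h2'
  -- Step 2: reindex to `(e, I)` and to the Option form with `π` on top of `(e, I)`.
  have hEI : AlgebraicIndependent ℚ ![e, I] := by
    have hinj : Function.Injective (![some 0, none] : Fin 2 → Option (Fin 2)) := by decide
    have hc := h3.comp _ hinj
    have hfun : ((fun o : Option (Fin 2) => o.elim I ![e, Real.pi]) ∘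
        (![some 0, none] : Fin 2 → Option (Fin 2))) = ![e, I] := by
      funext i; fin_cases i <;> rfl
    rwa [hfun] at hc
  have hπopt : AlgebraicIndependent ℚ (fun o : Option (Fin 2) => o.elim Real.pi ![e, I]) := by
    have hinj : Function.Injective
        (fun o : Option (Fin 2) => (o.elim (some 1) ![some 0, none] : Option (Fin 2))) := by
      decide
    have hc := h3.comp _ hinj
    have hfun : ((fun o : Option (Fin 2) => o.elim I ![e, Real.pi]) ∘
        (fun o : Option (Fin 2) => (o.elim (some 1) ![some 0, none] : Option (Fin 2))))
          = (fun o : Option (Fin 2) => o.elim Real.pi ![e, I]) := by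
      funext o
      rcases o with _ | i
      · rfl
      · fin_cases i <;> rfl
    rwa [hfun] at hc
  have hπK₀ : Transcendental (Algebra.adjoin ℚ (Set.range ![e, I])) Real.pi :=
    (hEI.option_iff_transcendental Real.pi).mp hπopt
  -- Step 3: pass to the field `K = ℚ(e, I)` and its relative algebraic closure `L` in `ℝ`.
  set K : IntermediateField ℚ ℝ := IntermediateField.adjoin ℚ (Set.range ![e, I]) with hK
  have hπK : Transcendental K Real.pi := IntermediateField.transcendental_adjoin_iff.mpr hπK₀
  set L : IntermediateField K ℝ := algebraicClosure K ℝ with hL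
  have hπL : Real.pi ∉ L := fun h => hπK (mem_algebraicClosure_iff.mp h)
  have heK : e ∈ K := IntermediateField.subset_adjoin ℚ _ ⟨0, rfl⟩
  have hIK : I ∈ K := IntermediateField.subset_adjoin ℚ _ ⟨1, rfl⟩
  have heL : e ∈ L := mem_algebraicClosure_iff.mpr (isAlgebraic_algebraMap (⟨e, heK⟩ : K))
  have hIL : I ∈ L := mem_algebraicClosure_iff.mpr (isAlgebraic_algebraMap (⟨I, hIK⟩ : K))
  -- Step 4: `J` is transcendental over `K` — else `√π = 2I + J/e ∈ L`, so `π ∈ L`.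
  have hJK : Transcendental K J := by
    intro hJalg
    have hJL : J ∈ L := mem_algebraicClosure_iff.mpr hJalg
    have hsqrt : Real.sqrt Real.pi ∈ L := by
      have hst : Real.sqrt Real.pi = 2 * I + e⁻¹ * J := stokesIdentity
      rw [hst, two_mul]
      exact add_mem (add_mem hIL hIL) (mul_mem (inv_mem heL) hJL)
    have hπmem : Real.pi ∈ L := by
      have : Real.pi = Real.sqrt Real.pi * Real.sqrt Real.pi :=
        (Real.mul_self_sqrt Real.pi_pos.le).symm
      rw [this]
      exact mul_mem hsqrt hsqrt
    exact hπL hπmem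
  have hJK₀ : Transcendental (Algebra.adjoin ℚ (Set.range ![e, I])) J :=
    IntermediateField.transcendental_adjoin_iff.mp hJK
  -- Step 5: adjoin `J` on top of `(e, I)` and reindex to `![e, I, J]`.
  have hopt : AlgebraicIndependent ℚ (fun o : Option (Fin 2) => o.elim J ![e, I]) :=
    (hEI.option_iff_transcendental J).mpr hJK₀
  have hinj : Function.Injective (![some 0, some 1, none] : Fin 3 → Option (Fin 2)) := by decide
  have hc := hopt.comp _ hinj
  have hfun : ((fun o : Option (Fin 2) => o.elim J ![e, I]) ∘
      (![some 0, some 1, none] : Fin 3 → Option (Fin 2))) = ![e, I, J] := by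
    funext i; fin_cases i <;> rfl
  rwa [hfun] at hc

/-- **The assembly** (BC2-redirect glue `X₁ → X₂ → MixedTripleIndependent`, PROVED, no sorry, standard
axioms): the two stubs' statements, verbatim, imply the crux's statement (kept UNFOLDED here; the
by-name form is `MixedTripleIndependent_of` below and, over the route decls, the glue item of the
split) — specialise the relative transcendence hypothesis at the algebraic point `a = 1` and run
`mixedTripleIndependent_of_instance`. -/
theorem mixedTripleIndependent_of_pieces
    (h1 : AlgebraicIndependent ℚ ![Real.exp 1, Real.pi])
    (h2 : ∀ a : ℝ, IsAlgebraic ℚ a → 0 < a →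
      Transcendental ↥(IntermediateField.adjoin ℚ ({Real.exp a, Real.pi} : Set ℝ))
        (∫ x in (0:ℝ)..1, Real.exp (-(a * x ^ 2)))) :
    AlgebraicIndependent ℚ ![Real.exp 1, ∫ x in (0:ℝ)..1, Real.exp (-x ^ 2),
      ∫ x in Set.Ioi (0:ℝ), Real.exp (-x) / Real.sqrt (1 + x)] := by
  have h := h2 1 isAlgebraic_one one_pos
  simp only [one_mul] at h
  exact mixedTripleIndependent_of_instance h1 h

/-- **The skeleton theorem**: the crux BY NAME from exactly the two registered stubs (sorries live only
inside `stub_ePiAlgIndependent`, `stub_gaussValueRelTranscendental`; everything else is proved). -/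
theorem MixedTripleIndependent_of : MixedTripleIndependent :=
  mixedTripleIndependent_of_pieces stub_ePiAlgIndependent stub_gaussValueRelTranscendental

end Summit.Schanuel.Schanuel.Cruxes.MixedTripleIndependent.SchanuelSplit
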